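import Mathlib
import Literature.Geometry.DiscreteGeometry.TwoShellChartSemantics
import Summits.AtomisticToContinuum.Crystallization.Theorems.NashClassCertificatesNashNearFieldStubChartCoreLabels

/-!
# Crux `NashClassCertificates.NashNearField` (stmt-AtomisticToContinuum-16827), line `birth`,
# stub `stub_labelledPlacement` — soundness I: the ACTUAL LABELS of the commons are an admissible candidate

For a good centre (`CentreGood`) and a good pivot witness (`PivotGood`) at a pivot `v ∈ cen`, every common
`c ∈ commonsOf cen v` has a LABEL (the name of its particle in the pivot's pattern); the labels are first-shell points,
distinct, and reproduce the distance classes (`labelPairOK`), by the landed metric lemmas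
(`norm_eq_one_of_label`, `dist_eq_one_of_labels`, `dist_sq_mem_of_labels_sqrt_two`).  Consequently the list of labels of
any list of commons is produced by the checker's enumeration `enumCands` (completeness of the enumeration, by induction),
i.e. the actual labelling is one of the candidates `candsOfCs`.
-/

noncomputable section

open Literature.Geometry.DiscreteGeometry Literature.Geometry.DiscreteGeometry.TwoShellCheck
  Literature.Geometry.DiscreteGeometry.TwoShellChart

namespace Summit.AtomisticToContinuum.Crystallization.Theorems.NashClassCertificatesNashNearField

variable {ι : Type*} {cen : List IVec} {pos : ι → EuclideanSpace ℝ (Fin 3)} {i₀ : ι} {fC : IVec → ι} {v : IVec}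
  {W : PivotW ι}

/-! ### Existence and metric quality of labels -/

/-- The particle of a common `c` of the pivot `v` sits within `1/20` of `pt c`. -/
theorem norm_commonParticle_sub_le (hC : CentreGood cen pos i₀ fC) {c : IVec} (hc : c ∈ commonsOf cen v) :
    ‖pos (commonParticle i₀ fC c) - pt c‖ ≤ 1 / 20 := by
  obtain ⟨h0, hpat, -, -⟩ := hC
  unfold commonParticle
  split_ifs with h
  · subst h; rw [h0, pt_zero, sub_zero, norm_zero]; norm_num
  · rcases (mem_commonsOf.1 hc).1 with h' | h'
    · exact absurd h' h
    · exact (hpat c h').2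

/-- The particle of a common of `v` is not the pivot particle `fC v`. -/
theorem commonParticle_ne (hC : CentreGood cen pos i₀ fC) (hv : v ∈ cen) {c : IVec} (hc : c ∈ commonsOf cen v) :
    commonParticle i₀ fC c ≠ fC v := by
  obtain ⟨-, hpat, hinj, -⟩ := hC
  have hc' := mem_commonsOf.1 hc
  unfold commonParticle
  split_ifs with h
  · exact (hpat v hv).1.symm
  · rcases hc'.1 with h' | h'
    · exact absurd h' h
    · intro heq
      have := hinj c h' v hv heq
      subst this
      have h18 := hc'.2
      simp [vsub, TwoShellCheck.sq] at h18

/-- Two commons with the same particle are equal. -/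
theorem eq_of_commonParticle_eq (hC : CentreGood cen pos i₀ fC) {c c' : IVec} (hc : c ∈ commonsOf cen v)
    (hc' : c' ∈ commonsOf cen v) (h : commonParticle i₀ fC c = commonParticle i₀ fC c') : c = c' := by
  obtain ⟨-, hpat, hinj, -⟩ := hC
  unfold commonParticle at h
  by_cases h1 : c = ((0 : ℤ), (0 : ℤ), (0 : ℤ)) <;> by_cases h2 : c' = ((0 : ℤ), (0 : ℤ), (0 : ℤ))
  · rw [h1, h2]
  · rw [if_pos h1, if_neg h2] at h
    rcases (mem_commonsOf.1 hc').1 with h' | h'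
    · exact absurd h' h2
    · exact absurd h.symm (hpat c' h').1
  · rw [if_neg h1, if_pos h2] at h
    rcases (mem_commonsOf.1 hc).1 with h' | h'
    · exact absurd h' h1
    · exact absurd h (hpat c h').1
  · rw [if_neg h1, if_neg h2] at h
    rcases (mem_commonsOf.1 hc).1 with h3 | h3
    · exact absurd h3 h1
    rcases (mem_commonsOf.1 hc').1 with h4 | h4
    · exact absurd h4 h2
    exact hinj c h3 c' h4 h

/-- `‖pt c − pt v‖ = 1` for a common `c` of `v`. -/
theorem norm_pt_sub_of_common {c : IVec} (hc : c ∈ commonsOf cen v) : ‖pt c - pt v‖ = 1 := by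
  have h := norm_pt_sub_sq c v
  rw [(mem_commonsOf.1 hc).2] at h
  norm_num at h
  have h0 : 0 ≤ ‖pt c - pt v‖ := norm_nonneg _
  rcases h with h | h
  · exact h
  · linarith

/-- The particle of a common is within `11/10` of the pivot particle. -/
theorem norm_commonParticle_sub_pivot_le (hC : CentreGood cen pos i₀ fC) (hv : v ∈ cen) {c : IVec}
    (hc : c ∈ commonsOf cen v) : ‖pos (commonParticle i₀ fC c) - pos (fC v)‖ ≤ 11 / 10 := by
  have h1 := norm_commonParticle_sub_le hC hc
  have h2 := (hC.2.1 v hv).2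
  have h3 := norm_pt_sub_of_common hc
  have key : pos (commonParticle i₀ fC c) - pos (fC v) =
      (pos (commonParticle i₀ fC c) - pt c) + (pt c - pt v) - (pos (fC v) - pt v) := by abel
  rw [key]
  calc ‖(pos (commonParticle i₀ fC c) - pt c) + (pt c - pt v) - (pos (fC v) - pt v)‖
      ≤ ‖(pos (commonParticle i₀ fC c) - pt c) + (pt c - pt v)‖ + ‖pos (fC v) - pt v‖ := norm_sub_le _ _
    _ ≤ ‖pos (commonParticle i₀ fC c) - pt c‖ + ‖pt c - pt v‖ + ‖pos (fC v) - pt v‖ := by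
        gcongr; exact norm_add_le _ _
    _ ≤ 1 / 20 + 1 + 1 / 20 := by rw [h3]; gcongr
    _ = 11 / 10 := by norm_num

/-- **Every common has a label.** -/
theorem exists_label (hC : CentreGood cen pos i₀ fC) (hv : v ∈ cen) (hW : PivotGood pos (fC v) W) {c : IVec}
    (hc : c ∈ commonsOf cen v) : ∃ w ∈ modelList W.t, W.fP w = commonParticle i₀ fC c := by
  obtain ⟨-, hρ1, -, -, -, hcomp⟩ := hW
  refine hcomp _ (commonParticle_ne hC hv hc) ((norm_commonParticle_sub_pivot_le hC hv hc).trans ?_)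
  linarith

/-- **Metric quality of a label**: `‖B (pt w) − (pt c − pt v)‖ ≤ 36/235`. -/
theorem norm_label_sub_le (hC : CentreGood cen pos i₀ fC) (hv : v ∈ cen) (hW : PivotGood pos (fC v) W) {c w : IVec}
    (hc : c ∈ commonsOf cen v) (hw : w ∈ modelList W.t) (hfw : W.fP w = commonParticle i₀ fC c) :
    ‖W.B (pt w) - (pt c - pt v)‖ ≤ 36 / 235 := by
  obtain ⟨-, -, hρ2, hpat, -, -⟩ := hW
  have h1 := norm_commonParticle_sub_le hC hc
  have h2 := (hC.2.1 v hv).2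
  have h3 := (hpat w hw).2
  rw [hfw] at h3
  have key : W.B (pt w) - (pt c - pt v) =
      (pos (commonParticle i₀ fC c) - pt c) - (pos (fC v) - pt v) -
        (pos (commonParticle i₀ fC c) - (pos (fC v) + W.B (pt w))) := by abel
  rw [key]
  calc _ ≤ ‖(pos (commonParticle i₀ fC c) - pt c) - (pos (fC v) - pt v)‖ +
        ‖pos (commonParticle i₀ fC c) - (pos (fC v) + W.B (pt w))‖ := norm_sub_le _ _
    _ ≤ ‖pos (commonParticle i₀ fC c) - pt c‖ + ‖pos (fC v) - pt v‖ +
        ‖pos (commonParticle i₀ fC c) - (pos (fC v) + W.B (pt w))‖ := by gcongr; exact norm_sub_le _ _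
    _ ≤ 1 / 20 + 1 / 20 + W.ρ / 20 := by gcongr
    _ ≤ 36 / 235 := by linarith

/-- **Labels are first-shell points**: `sq w = 18`. -/
theorem sq_label (hC : CentreGood cen pos i₀ fC) (hv : v ∈ cen) (hW : PivotGood pos (fC v) W) {c w : IVec}
    (hc : c ∈ commonsOf cen v) (hw : w ∈ modelList W.t) (hfw : W.fP w = commonParticle i₀ fC c) :
    TwoShellCheck.sq w = 18 := by
  rw [← norm_pt_eq_one_iff]
  exact norm_eq_one_of_label hW.1 hW.2.1 (norm_pt_sub_of_common hc) (norm_pt_of_mem hw)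
    (norm_label_sub_le hC hv hW hc hw hfw)

/-- Labels of distinct commons are distinct. -/
theorem label_ne (hC : CentreGood cen pos i₀ fC) {c c' w w' : IVec}
    (hc : c ∈ commonsOf cen v) (hc' : c' ∈ commonsOf cen v) (hcc : c ≠ c')
    (hfw : W.fP w = commonParticle i₀ fC c) (hfw' : W.fP w' = commonParticle i₀ fC c') : w ≠ w' := by
  intro h
  subst h
  exact hcc (eq_of_commonParticle_eq hC hc hc' (hfw.symm.trans hfw'))

/-- `sq (w − w') = 18 · dist²` in the pattern. -/
theorem sq_vsub_eq_of_dist (w w' : IVec) : (TwoShellCheck.sq (vsub w w') : ℝ) = 18 * dist (pt w) (pt w') ^ 2 := by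
  rw [dist_eq_norm, norm_pt_sub_sq]; ring

/-- **The distance classes of two labels** (`labelPairOK`). -/
theorem labelPairOK_labels (hC : CentreGood cen pos i₀ fC) (hv : v ∈ cen) (hW : PivotGood pos (fC v) W)
    {c c' w w' : IVec} (hc : c ∈ commonsOf cen v) (hc' : c' ∈ commonsOf cen v) (hcc : c ≠ c')
    (hw : w ∈ modelList W.t) (hw' : w' ∈ modelList W.t)
    (hfw : W.fP w = commonParticle i₀ fC c) (hfw' : W.fP w' = commonParticle i₀ fC c') :
    labelPairOK (TwoShellCheck.sq (vsub c c')) (TwoShellCheck.sq (vsub w w')) = true := by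
  have hne : w ≠ w' := label_ne hC hc hc' hcc hfw hfw'
  have hS0 : TwoShellCheck.sq (vsub w w') ≠ 0 := by
    intro h0
    apply hne
    apply pt_injective
    have := norm_pt_sub_sq w w'
    rw [h0] at this
    norm_num at this
    exact sub_eq_zero.1 this
  have h1 : ‖pt w‖ = 1 := (norm_pt_eq_one_iff w).2 (sq_label hC hv hW hc hw hfw)
  have h1' : ‖pt w'‖ = 1 := (norm_pt_eq_one_iff w').2 (sq_label hC hv hW hc' hw' hfw')
  have hb := norm_label_sub_le hC hv hW hc hw hfw
  have hb' := norm_label_sub_le hC hv hW hc' hw' hfw'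
  have hP := patternOf_eq_or W.t
  have hdist : dist (pt c - pt v) (pt c' - pt v) ^ 2 = (TwoShellCheck.sq (vsub c c') : ℝ) / 18 := by
    rw [dist_eq_norm, show pt c - pt v - (pt c' - pt v) = pt c - pt c' by abel, norm_pt_sub_sq]
  unfold labelPairOK
  rw [Bool.and_eq_true, bne_iff_ne]
  refine ⟨hS0, ?_⟩
  by_cases h18 : TwoShellCheck.sq (vsub c c') = 18
  · rw [if_pos (beq_iff_eq.2 h18), beq_iff_eq]
    rw [h18] at hdist
    have hd1 : dist (pt c - pt v) (pt c' - pt v) = 1 := by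
      have h0 : 0 ≤ dist (pt c - pt v) (pt c' - pt v) := dist_nonneg
      nlinarith
    have := dist_eq_one_of_labels hW.1 hW.2.1 hP (pt_mem_pattern hw) (pt_mem_pattern hw') h1 h1' hd1 hb hb'
    have h2 := sq_vsub_eq_of_dist w w'
    rw [this] at h2
    norm_num at h2
    exact_mod_cast h2
  · rw [if_neg (by rwa [beq_iff_eq])]
    by_cases h36 : TwoShellCheck.sq (vsub c c') = 36
    · rw [if_pos (beq_iff_eq.2 h36)]
      rw [h36] at hdist
      have hd2 : dist (pt c - pt v) (pt c' - pt v) = Real.sqrt 2 := by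
        rw [← Real.sqrt_sq (dist_nonneg : 0 ≤ dist (pt c - pt v) (pt c' - pt v)), hdist]
        norm_num
      have := dist_sq_mem_of_labels_sqrt_two hW.1 hW.2.1 hW.2.2.1 hP (pt_mem_pattern hw) (pt_mem_pattern hw')
        h1 h1' hd2 hb hb'
      have h2 := sq_vsub_eq_of_dist w w'
      simp only [Bool.or_eq_true, beq_iff_eq]
      rcases this with h | h | h <;> rw [h] at h2 <;> norm_num at h2
      · left; left; exact_mod_cast h2
      · left; right; exact_mod_cast h2
      · right; exact_mod_cast h2
    · rw [if_neg (by rwa [beq_iff_eq])]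

/-! ### Completeness of the enumeration -/

/-- `labelOK` from the pairwise classes against the head common. -/
theorem labelOK_of_forall {cs phi : List IVec} {c w : IVec}
    (h : ∀ k (hk : k < cs.length) (hk' : k < phi.length),
      labelPairOK (TwoShellCheck.sq (vsub c (cs[k]))) (TwoShellCheck.sq (vsub w (phi[k]))) = true) :
    labelOK cs phi c w = true := by
  unfold labelOK
  rw [List.all_eq_true]
  intro cw hcw
  obtain ⟨k, hk, hk2⟩ := List.mem_iff_getElem.1 hcw
  rw [List.length_zip] at hk
  have hk1 : k < cs.length := lt_of_lt_of_le hk (min_le_left _ _)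
  have hk3 : k < phi.length := lt_of_lt_of_le hk (min_le_right _ _)
  have := h k hk1 hk3
  rw [List.getElem_zip] at hk2
  rw [← hk2]
  exact this

/-- **Completeness of `enumCands`**: an aligned label list all of whose labels lie in `us` and all of whose pairs pass
`labelPairOK` is enumerated. -/
theorem mem_enumCands {us : List IVec} :
    ∀ (cs phi : List IVec), cs.length = phi.length → (∀ w ∈ phi, w ∈ us) →
      (∀ i j (hi : i < cs.length) (hj : j < cs.length) (hi' : i < phi.length) (hj' : j < phi.length), i < j →
        labelPairOK (TwoShellCheck.sq (vsub (cs[i]) (cs[j]))) (TwoShellCheck.sq (vsub (phi[i]) (phi[j]))) = true) →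
      phi ∈ enumCands us cs
  | [], [], _, _, _ => by simp [enumCands]
  | [], _ :: _, h, _, _ => by simp at h
  | _ :: _, [], h, _, _ => by simp at h
  | c :: cs, w :: phi, hlen, hus, hpair => by
    simp only [List.length_cons, add_left_inj] at hlen
    rw [enumCands, List.mem_flatMap]
    refine ⟨phi, mem_enumCands cs phi hlen (fun w' hw' => hus w' (List.mem_cons_of_mem _ hw')) ?_, ?_⟩
    · intro i j hi hj hi' hj' hij
      have := hpair (i + 1) (j + 1) (by simpa using hi) (by simpa using hj) (by simpa using hi') (by simpa using hj')
        (by omega)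
      simpa using this
    · rw [List.mem_map]
      refine ⟨w, List.mem_filter.2 ⟨hus w List.mem_cons_self, ?_⟩, rfl⟩
      refine labelOK_of_forall fun k hk hk' => ?_
      have := hpair 0 (k + 1) (by simp) (by simpa using hk) (by simp) (by simpa using hk') (by omega)
      simpa using this

/-- The actual labelling of a list of distinct commons is admissible pairwise and consists of first-shell points,
hence is a candidate of `candsOfCs`. -/
theorem mem_candsOfCs (hC : CentreGood cen pos i₀ fC) (hv : v ∈ cen) (hW : PivotGood pos (fC v) W)
    {cs phi : List IVec} (hcs : ∀ c ∈ cs, c ∈ commonsOf cen v) (hnd : cs.Nodup) (hL : LabelsOK i₀ fC W cs phi) :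
    (W.t, phi) ∈ candsOfCs cs := by
  have hlen : cs.length = phi.length := hL.length_eq
  have hget : ∀ k (hk : k < cs.length) (hk' : k < phi.length),
      phi[k] ∈ modelList W.t ∧ W.fP (phi[k]) = commonParticle i₀ fC (cs[k]) := fun k hk hk' =>
    List.Forall₂.get hL hk hk'
  have hus : ∀ w ∈ phi, w ∈ units (modelList W.t) := by
    intro w hw
    obtain ⟨k, hk', rfl⟩ := List.mem_iff_getElem.1 hw
    have hk : k < cs.length := by omega
    obtain ⟨hm, hf⟩ := hget k hk hk'
    exact List.mem_filter.2 ⟨hm, beq_iff_eq.2 (sq_label hC hv hW (hcs _ (List.getElem_mem hk)) hm hf)⟩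
  have hpair : ∀ i j (hi : i < cs.length) (hj : j < cs.length) (hi' : i < phi.length) (hj' : j < phi.length), i < j →
      labelPairOK (TwoShellCheck.sq (vsub (cs[i]) (cs[j]))) (TwoShellCheck.sq (vsub (phi[i]) (phi[j]))) = true := by
    intro i j hi hj hi' hj' hij
    obtain ⟨hmi, hfi⟩ := hget i hi hi'
    obtain ⟨hmj, hfj⟩ := hget j hj hj'
    refine labelPairOK_labels hC hv hW (hcs _ (List.getElem_mem hi)) (hcs _ (List.getElem_mem hj)) ?_ hmi hmj hfi hfj
    intro heq
    exact absurd (hnd.getElem_inj_iff.1 heq) (by omega)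
  have hmem := mem_enumCands (us := units (modelList W.t)) cs phi hlen hus hpair
  unfold candsOfCs
  rw [List.mem_append, List.mem_map, List.mem_map]
  cases ht : W.t
  · left; exact ⟨phi, by rw [ht] at hmem; exact hmem, rfl⟩
  · right; exact ⟨phi, by rw [ht] at hmem; exact hmem, rfl⟩

/-- **The actual labelling exists**: for any list of commons there is an aligned list of correct labels. -/
theorem exists_labelsOK (hC : CentreGood cen pos i₀ fC) (hv : v ∈ cen) (hW : PivotGood pos (fC v) W) :
    ∀ cs : List IVec, (∀ c ∈ cs, c ∈ commonsOf cen v) → ∃ phi, LabelsOK i₀ fC W cs phi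
  | [], _ => ⟨[], List.Forall₂.nil⟩
  | c :: cs, hcs => by
    obtain ⟨w, hw, hfw⟩ := exists_label hC hv hW (hcs c List.mem_cons_self)
    obtain ⟨phi, hphi⟩ := exists_labelsOK hC hv hW cs fun c' hc' => hcs c' (List.mem_cons_of_mem _ hc')
    exact ⟨w :: phi, List.Forall₂.cons ⟨hw, hfw⟩ hphi⟩

/-- **Registered sub-goal `stub_labelledPlacementEnum` of crux stmt-AtomisticToContinuum-16827** (landing anchor of this file,
re-exporting `mem_enumCands`). -/
theorem stub_labelledPlacementEnum : ∀ (us cs phi : List Literature.Geometry.DiscreteGeometry.TwoShellCheck.IVec), cs.length = phi.length → (∀ w ∈ phi, w ∈ us) → (∀ (i j : ℕ) (hi : i < cs.length) (hj : j < cs.length) (hi' : i < phi.length) (hj' : j < phi.length), i < j → Literature.Geometry.DiscreteGeometry.TwoShellChart.labelPairOK (Literature.Geometry.DiscreteGeometry.TwoShellCheck.sq (Literature.Geometry.DiscreteGeometry.TwoShellCheck.vsub (cs[i]) (cs[j]))) (Literature.Geometry.DiscreteGeometry.TwoShellCheck.sq (Literature.Geometry.DiscreteGeometry.TwoShellCheck.vsub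 (phi[i]) (phi[j]))) = true) → phi ∈ Literature.Geometry.DiscreteGeometry.TwoShellChart.enumCands us cs :=
  fun _ cs phi h1 h2 h3 => mem_enumCands cs phi h1 h2 h3

end Summit.AtomisticToContinuum.Crystallization.Theorems.NashClassCertificatesNashNearField

end
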